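import Mathlib

/-!
# Invariants commute with extension of scalars — Lemma B5.6 of sub-claim B5

Blind cell `pub-hodge-repro2`, Tier 4 (README §6.1), sub-claim B5 (owner p8; prose in
`route/T4-B5-p8.md`, Lemma B5.6). Companion of `LevelPositivity.lean` (same namespace; not imported —
nothing from it is needed here).

Statement formalised: let `M` be a field, `C` an `M`-algebra, `V` an `M`-vector space with a
representation `ρ` of a group `G` (the prose: `M = M̃_μ ⊂ ℂ = C`, `V = Ω(μ)`, `G = K` an open compact
subgroup acting `M̃_μ`-linearly). Let `ρ.baseChange C` be the induced representation on `C ⊗[M] V`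
(`g ↦ (ρ g).baseChange C`). Then the `C`-subspace of `G`-invariants of `C ⊗[M] V` is exactly the
base change `(ρ.invariants).baseChange C` of the `M`-subspace of `G`-invariants of `V`
(`invariants_baseChange`), hence `dim_C (C ⊗ V)^G = dim_M V^G` (`finrank_invariants_baseChange`,
stated for finite-dimensional invariants).

Proof (as in the prose): choose an `M`-basis `(b_j)` of `C`; under `C ⊗[M] V ≃ (ι →₀ V)`,
`x ↦ (v_j)_j` with `x = Σ b_j ⊗ v_j`, the base-changed action is the componentwise action
`(v_j) ↦ (ρ g v_j)`, so `x` is fixed iff every `v_j` is. No `sorry`; standard axioms only.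
-/

namespace Summit.Ventures.HodgeRepro2.LevelPositivity

noncomputable section

open TensorProduct

section BaseChange

variable {G : Type*} [Group G]
variable {M : Type*} [Field M] {C : Type*} [CommRing C] [Algebra M C]
variable {V : Type*} [AddCommGroup V] [Module M V]

/-- The representation of `G` on `C ⊗[M] V` obtained from `ρ` by extension of scalars:
`g` acts by `(ρ g).baseChange C` (`c ⊗ v ↦ c ⊗ ρ g v`). -/
def baseChangeRep (ρ : Representation M G V) : Representation C G (C ⊗[M] V) :=
  (Module.End.baseChangeHom M C V).toMonoidHom.comp ρ

/-- The base-changed action on a pure tensor. -/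
@[simp] theorem baseChangeRep_tmul (ρ : Representation M G V) (g : G) (c : C) (v : V) :
    baseChangeRep ρ g (c ⊗ₜ[M] v) = c ⊗ₜ[M] ρ g v := by
  simp [baseChangeRep, Module.End.baseChangeHom, LinearMap.baseChange_tmul]

/-- Membership in the invariants of the base change. -/
theorem mem_invariants_baseChangeRep_iff (ρ : Representation M G V) (x : C ⊗[M] V) :
    x ∈ (baseChangeRep ρ).invariants ↔ ∀ g : G, baseChangeRep ρ g x = x :=
  Representation.mem_invariants _ x

/-- The easy inclusion of Lemma B5.6: `V^G ⊗_M C ⊆ (C ⊗_M V)^G`. -/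
theorem baseChange_invariants_le (ρ : Representation M G V) :
    (ρ.invariants).baseChange C ≤ (baseChangeRep ρ).invariants := by
  rw [Submodule.baseChange_eq_span, Submodule.span_le]
  rintro _ ⟨v, hv, rfl⟩
  rw [SetLike.mem_coe, mem_invariants_baseChangeRep_iff]
  intro g
  simp only [TensorProduct.mk_apply, baseChangeRep_tmul]
  rw [(Representation.mem_invariants ρ v).1 hv g]

/-- The coordinate description of `C ⊗[M] V` attached to an `M`-basis `b` of `C`:
`C ⊗[M] V ≃ₗ[M] (ι →₀ V)`, `Σ_j b_j ⊗ v_j ↦ (v_j)_j`. -/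
def coordEquiv {ι : Type*} [DecidableEq ι] (b : Module.Basis ι M C) : C ⊗[M] V ≃ₗ[M] (ι →₀ V) :=
  (TensorProduct.congr b.repr (LinearEquiv.refl M V)) ≪≫ₗ TensorProduct.finsuppScalarLeft M V ι

/-- `coordEquiv` on a pure tensor, coordinatewise. -/
theorem coordEquiv_tmul_apply {ι : Type*} [DecidableEq ι] (b : Module.Basis ι M C) (c : C) (v : V) (i : ι) :
    coordEquiv b (c ⊗ₜ[M] v) i = b.repr c i • v := by
  simp [coordEquiv]

/-- The inverse of `coordEquiv` on a single coordinate vector. -/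
theorem coordEquiv_symm_single {ι : Type*} [DecidableEq ι] (b : Module.Basis ι M C) (i : ι) (v : V) :
    (coordEquiv b).symm (Finsupp.single i v) = b i ⊗ₜ[M] v := by
  simp [coordEquiv]

/-- Under `coordEquiv`, the base-changed action of `g` is the coordinatewise action of `ρ g`. -/
theorem coordEquiv_baseChangeRep {ι : Type*} [DecidableEq ι] (b : Module.Basis ι M C)
    (ρ : Representation M G V) (g : G) (x : C ⊗[M] V) (i : ι) :
    coordEquiv b (baseChangeRep ρ g x) i = ρ g (coordEquiv b x i) := by
  induction x using TensorProduct.induction_on with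
  | zero => simp
  | tmul c v => rw [baseChangeRep_tmul, coordEquiv_tmul_apply, coordEquiv_tmul_apply, map_smul]
  | add x y hx hy => simp only [map_add, Finsupp.add_apply, hx, hy]

/-- Lemma B5.6 (the hard inclusion): a `G`-invariant element of `C ⊗_M V` lies in
`V^G ⊗_M C`. -/
theorem invariants_baseChangeRep_le (ρ : Representation M G V) :
    (baseChangeRep ρ).invariants ≤ (ρ.invariants).baseChange C := by
  intro x hx
  classical
  let b := Module.Free.chooseBasis M C
  have hcoord : ∀ i, coordEquiv b x i ∈ ρ.invariants := by
    intro i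
    rw [Representation.mem_invariants]
    intro g
    rw [← coordEquiv_baseChangeRep b ρ g x i, (mem_invariants_baseChangeRep_iff ρ x).1 hx g]
  have hx' : x = (coordEquiv b).symm (coordEquiv b x) := ((coordEquiv b).symm_apply_apply x).symm
  rw [hx', ← Finsupp.sum_single (coordEquiv b x), map_finsuppSum]
  refine Submodule.finsuppSum_mem _ _ _ _ fun i _ => ?_
  rw [coordEquiv_symm_single]
  exact Submodule.tmul_mem_baseChange_of_mem _ (hcoord i)

/-- **Lemma B5.6.** The `G`-invariants of the base change `C ⊗_M V` are the base change of the
`G`-invariants of `V`: `(C ⊗_M V)^G = V^G ⊗_M C`. -/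
theorem invariants_baseChange (ρ : Representation M G V) :
    (baseChangeRep ρ).invariants = (ρ.invariants).baseChange C :=
  le_antisymm (invariants_baseChangeRep_le ρ) (baseChange_invariants_le ρ)

end BaseChange

section Dimension

variable {G : Type*} [Group G]
variable {M : Type*} [Field M] {C : Type*} [Field C] [Algebra M C]
variable {V : Type*} [AddCommGroup V] [Module M V]

/-- Lemma B5.6, the dimension count: when `V^G` is finite-dimensional over `M`,
`dim_C (C ⊗_M V)^G = dim_M V^G`. -/
theorem finrank_invariants_baseChange (ρ : Representation M G V) :
    Module.finrank C (baseChangeRep (C := C) ρ).invariants = Module.finrank M ρ.invariants := by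
  rw [invariants_baseChange]
  -- `p.baseChange C = range (p.subtype.baseChange C)`, and that map is injective because `C` is
  -- flat over the field `M`; so `p.baseChange C ≃ C ⊗[M] p`, whose `C`-dimension is `dim_M p`.
  have hinj : Function.Injective ((ρ.invariants).subtype.baseChange C) := by
    rw [LinearMap.baseChange_eq_ltensor]
    exact Module.Flat.lTensor_preserves_injective_linearMap _ (ρ.invariants).subtype_injective
  have e : C ⊗[M] ρ.invariants ≃ₗ[C] (ρ.invariants).baseChange C :=
    LinearEquiv.ofInjective _ hinj
  rw [← e.finrank_eq]
  exact Module.finrank_baseChange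

end Dimension

end

end Summit.Ventures.HodgeRepro2.LevelPositivity
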